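import Literature.NumberTheory.EllipticCurves.Kato2004.IwasawaInvolutionTwistProofs
import Literature.NumberTheory.EllipticCurves.IwasawaSelmerIsTorsionProofs
import HarnessLib

/-!
# The `μ`- and `λ`-invariants and the lengths at `ι`-fixed primes are INVARIANT under the Iwasawa-involution
# twist `M ↦ M^ι` (proofs only; 0 def, 0 fact)

Topic `NumberTheory/EllipticCurves` (next to `IwasawaAlgebraInvolution.lean`, `IwasawaAlgebraInvolutionFixedPrimesProofs.lean`;
namespace `Literature.NumberTheory.EllipticCurves.IwasawaAlgebra`). Sequel of `Kato2004/IwasawaInvolutionTwistProofs.lean`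
§2 (transport along an `ι`-semilinear additive equivalence `e : M ≃+ N`, `e (f • m) = ι f • e m`, i.e. "`N = M^ι`":
`Kato2004.lengthAt_eq_of_involSemilinear`, `ℓ_𝔓(N) = ℓ_{ι𝔓}(M)`). THEOREMS ONLY; no definition, no named fact, no `instance`,
no `sorry`.

What is proved, for `ι = IwasawaAlgebra.invol p` and any `ι`-semilinear `e : M ≃+ N`:
* `lengthAt_eq_of_involSemilinear_of_comap_eq` — at an `ι`-FIXED prime (`PrimeSpectrum.comap ι 𝔓 = 𝔓`) the local
  lengths of `M` and `M^ι` agree; instances `…_primeT` (the augmentation prime `(T)`) and `…_of_asIdeal_eq_augIdealP`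
  (the prime `(p)`), by `comap_invol_primeT` / `comap_invol_eq_self_of_asIdeal_eq_augIdealP`.
* `muInvariant_eq_of_involSemilinear` — `μ(M^ι) = μ(M)` (`μ` is a sum of lengths at points with ideal `(p)`, all
  `ι`-fixed).
* `lambdaInvariant_eq_of_involSemilinear` — `λ(M^ι) = λ(M)` (`ι` fixes constants, so `e` is `ℤ_p`-linear on the underlying
  `ℤ_p`-modules and base-changes to a `ℚ_p`-linear equivalence).
So «`μ = …`», «`λ = …`», «order of vanishing at `T`» statements about a `Λ`-module are insensitive to the keying
`M` vs `M^ι` (Greenberg's two `Λ`-structures on a Pontryagin dual); only the position of the other height-one primes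
moves (`𝔓 ↦ ι𝔓`). Consumers: the ♯/♭ and fine keying dictionaries (`Sprung2012/SharpFlatSelmerDualInvolutionTwistProofs`,
`Kato2004/IwasawaInvolutionTwistProofs`).

References: R. Greenberg, LNM 1716 (1999) §1 p. 60 [GreenbergLNM1716]; L. Washington, GTM 83, §13.2 [Washington1997];
B. Mazur, J. Tate, J. Teitelbaum, Invent. Math. 84 (1986) Ch. I §17 [MazurTateTeitelbaum1986Invent].
-/

noncomputable section

open scoped TensorProduct

namespace Literature.NumberTheory.EllipticCurves.IwasawaAlgebra

open Literature.NumberTheory.EllipticCurves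

variable {p : ℕ} [Fact p.Prime]
  {M : Type*} [AddCommGroup M] [Module (IwasawaAlgebra p) M]
  {N : Type*} [AddCommGroup N] [Module (IwasawaAlgebra p) N]

/-- **At an `ι`-fixed prime the twist does not change the local length**: if `ι𝔓 = 𝔓` then `ℓ_𝔓(M^ι) = ℓ_𝔓(M)`
for any `ι`-semilinear `e : M ≃+ N`. [cite: GreenbergLNM1716, §1 (p. 60)] [cite: Washington1997, §13.2] -/
theorem lengthAt_eq_of_involSemilinear_of_comap_eq (e : M ≃+ N)
    (he : ∀ (f : IwasawaAlgebra p) (m : M), e (f • m) = invol p f • e m)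
    (𝔓 : PrimeSpectrum (IwasawaAlgebra p)) (h𝔓 : PrimeSpectrum.comap (invol p).toRingHom 𝔓 = 𝔓) :
    Module.lengthAt (IwasawaAlgebra p) N 𝔓 = Module.lengthAt (IwasawaAlgebra p) M 𝔓 := by
  rw [Kato2004.lengthAt_eq_of_involSemilinear e he 𝔓, h𝔓]

/-- The twist does not change the length at the augmentation prime `(T)` (`ι(T) = (T)`): orders of vanishing at
`T = 0` are keying-insensitive. [cite: Washington1997, §13.2] [cite: MazurTateTeitelbaum1986Invent, Ch. I §17] -/
theorem lengthAt_primeT_eq_of_involSemilinear (e : M ≃+ N)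
    (he : ∀ (f : IwasawaAlgebra p) (m : M), e (f • m) = invol p f • e m) :
    Module.lengthAt (IwasawaAlgebra p) N (primeT p) = Module.lengthAt (IwasawaAlgebra p) M (primeT p) :=
  lengthAt_eq_of_involSemilinear_of_comap_eq e he (primeT p) (comap_invol_primeT p)

/-- The twist does not change the length at the prime `(p)` (`ι` fixes constants). [cite: Washington1997, §13.2] -/
theorem lengthAt_eq_of_involSemilinear_of_asIdeal_eq_augIdealP (e : M ≃+ N)
    (he : ∀ (f : IwasawaAlgebra p) (m : M), e (f • m) = invol p f • e m)
    (𝔓 : PrimeSpectrum (IwasawaAlgebra p)) (h𝔓 : 𝔓.asIdeal = augIdealP p) :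
    Module.lengthAt (IwasawaAlgebra p) N 𝔓 = Module.lengthAt (IwasawaAlgebra p) M 𝔓 :=
  lengthAt_eq_of_involSemilinear_of_comap_eq e he 𝔓 (comap_invol_eq_self_of_asIdeal_eq_augIdealP p 𝔓 h𝔓)

/-- **`μ(M^ι) = μ(M)`**: the `μ`-invariant (`muInvariant`, the sum of the local lengths at the points of `Spec Λ` with
ideal `(p)`) is invariant under the Iwasawa-involution twist, because `ι` fixes `(p)`.
[cite: Washington1997, §13.2] [cite: GreenbergLNM1716, §1 (p. 60)] -/
theorem muInvariant_eq_of_involSemilinear (e : M ≃+ N)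
    (he : ∀ (f : IwasawaAlgebra p) (m : M), e (f • m) = invol p f • e m) :
    muInvariant p N = muInvariant p M := by
  unfold muInvariant
  refine finsum_congr fun 𝔓 ↦ finsum_congr fun h𝔓 ↦ ?_
  rw [lengthAt_eq_of_involSemilinear_of_asIdeal_eq_augIdealP e he 𝔓 h𝔓]

/-- **`λ(M^ι) = λ(M)`**: the `λ`-invariant (`lambdaInvariant`, `dim_{ℚ_p}(ℚ_p ⊗_{ℤ_p} M)`) is invariant under the
Iwasawa-involution twist: since `ι (C a) = C a`, an `ι`-semilinear `e : M ≃+ N` is `ℤ_p`-LINEAR on the underlying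
`ℤ_p`-modules, and base-changes to a `ℚ_p`-linear equivalence. [cite: Washington1997, §13.2] [cite: GreenbergLNM1716, §1 (p. 60)] -/
theorem lambdaInvariant_eq_of_involSemilinear (e : M ≃+ N)
    (he : ∀ (f : IwasawaAlgebra p) (m : M), e (f • m) = invol p f • e m) :
    lambdaInvariant p N = lambdaInvariant p M := by
  -- the `ℤ_p`-linear equivalence underlying `e`, on the `RestrictScalars` synonyms
  let e' : RestrictScalars ℤ_[p] (IwasawaAlgebra p) M ≃ₗ[ℤ_[p]]
      RestrictScalars ℤ_[p] (IwasawaAlgebra p) N :=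
    { ((RestrictScalars.addEquiv ℤ_[p] (IwasawaAlgebra p) M).trans e).trans
        (RestrictScalars.addEquiv ℤ_[p] (IwasawaAlgebra p) N).symm with
      map_smul' := fun a x ↦ by
        change e (algebraMap ℤ_[p] (IwasawaAlgebra p) a • (RestrictScalars.addEquiv ℤ_[p] (IwasawaAlgebra p) M x)) =
          algebraMap ℤ_[p] (IwasawaAlgebra p) a • e (RestrictScalars.addEquiv ℤ_[p] (IwasawaAlgebra p) M x)
        rw [he, PowerSeries.algebraMap_eq, invol_C] }
  unfold lambdaInvariant
  exact ((e'.baseChange ℤ_[p] ℚ_[p] _ _).finrank_eq).symm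

/-! ## §3 Kernels of `ι`-semilinear functionals on `Λ`-modules of rank `≤ 1`

(Appended 2026-08-28, cell `bsd-ssimc`, crux `SprungLowerDivisibilityAtThree`, stub `K_spor`: idea card
`stub-katofinelowersporadic-k2-g4` §A.) An `ι`-SEMILINEAR functional `Ψ : X → Λ` (`Ψ(r·x) = ι(r)·Ψ(x)`, e.g. a
value of the `ι`-twisted duality `X → Hom_Λ(𝐇¹, Λ)^ι → Λ`) on a `Λ`-module of rank `≤ 1` which does not vanish
identically has kernel EXACTLY the `Λ`-torsion of `X`: any two elements of `X` are dependent, `Λ` is a domain and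
`ι` is injective. This retires the displayed «`ker Ψ = tors X`» clause of the duality-ledger helper H2. -/

/-- Any two elements of a module of rank `≤ 1` over a non-trivial commutative ring satisfy a non-trivial linear
relation (a linearly independent pair would give rank `≥ 2`). Private helper. [folklore] -/
private theorem exists_smul_add_smul_eq_zero_of_rank_le_one {R X : Type*} [CommRing R] [Nontrivial R]
    [AddCommGroup X] [Module R X] (hX : Module.rank R X ≤ 1) (x y : X) :
    ∃ s t : R, ¬(s = 0 ∧ t = 0) ∧ s • x + t • y = 0 := by
  by_contra h
  push Not at h
  have hli : LinearIndependent R ![x, y] :=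
    LinearIndependent.pair_iff.mpr fun s t hst ↦ by
      by_contra hne
      exact h s t (fun hs ht ↦ hne ⟨hs, ht⟩) hst
  have h2 := hli.cardinal_lift_le_rank
  rw [Cardinal.mk_fin, Cardinal.lift_natCast] at h2
  have h3 : ((2 : ℕ) : Cardinal) ≤ Cardinal.lift 1 := h2.trans (Cardinal.lift_le.mpr hX)
  rw [Cardinal.lift_one] at h3
  have h4 : (2 : ℕ) ≤ 1 := by exact_mod_cast h3
  omega

/-- **Kernel of a non-zero `ι`-semilinear functional on a rank-`≤ 1` module = the torsion.** Let `X` be a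
`Λ`-module with `rank_Λ X ≤ 1` and `Ψ : X →+ Λ` additive with `Ψ (r • x) = ι r * Ψ x` for the Iwasawa involution
`ι`, not identically zero. Then `Ψ x = 0 ↔ x ∈ tors_Λ X`. (`⇐`: `a • x = 0`, `a ≠ 0` gives `ι a · Ψ x = 0` with
`ι a ≠ 0`; `⇒`: a relation `s • x + t • y = 0` with `Ψ y ≠ 0` forces `t = 0` after applying `Ψ`, so `s ≠ 0` kills
`x`.) Greenberg's two `Λ`-structures on a dual differ exactly by such an `ι`. [cite: GreenbergLNM1716, §1 (p. 60)] -/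
theorem involSemilinear_apply_eq_zero_iff_mem_torsion {X : Type*} [AddCommGroup X]
    [Module (IwasawaAlgebra p) X] (hX : Module.rank (IwasawaAlgebra p) X ≤ 1) (Ψ : X →+ IwasawaAlgebra p)
    (hΨ : ∀ (r : IwasawaAlgebra p) (x : X), Ψ (r • x) = invol p r * Ψ x) (hne : ∃ y, Ψ y ≠ 0) (x : X) :
    Ψ x = 0 ↔ x ∈ Submodule.torsion (IwasawaAlgebra p) X := by
  constructor
  · intro hx
    obtain ⟨y, hy⟩ := hne
    obtain ⟨s, t, hst, hrel⟩ := exists_smul_add_smul_eq_zero_of_rank_le_one hX x y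
    have h := congrArg Ψ hrel
    rw [map_add, hΨ, hΨ, hx, mul_zero, zero_add, map_zero] at h
    have ht : t = 0 :=
      invol_injective p (by rw [map_zero]; exact (mul_eq_zero.mp h).resolve_right hy)
    have hs : s ≠ 0 := fun hs ↦ hst ⟨hs, ht⟩
    rw [ht, zero_smul, add_zero] at hrel
    exact (Submodule.mem_torsion_iff x).mpr ⟨⟨s, mem_nonZeroDivisors_of_ne_zero hs⟩, hrel⟩
  · intro hx
    obtain ⟨⟨a, ha⟩, hax⟩ := (Submodule.mem_torsion_iff x).mp hx
    have h := congrArg Ψ (show a • x = 0 from hax)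
    rw [hΨ, map_zero] at h
    refine (mul_eq_zero.mp h).resolve_left fun h0 ↦ ?_
    exact nonZeroDivisors.ne_zero ha (invol_injective p (by rw [h0, map_zero]))

/-- The same read as «`Ψ` factors through `X / tors X` and is injective there»: two elements with the same value
under a non-zero `ι`-semilinear functional on a rank-`≤ 1` module differ by torsion. [cite: GreenbergLNM1716, §1 (p. 60)] -/
theorem sub_mem_torsion_of_involSemilinear_apply_eq {X : Type*} [AddCommGroup X]
    [Module (IwasawaAlgebra p) X] (hX : Module.rank (IwasawaAlgebra p) X ≤ 1) (Ψ : X →+ IwasawaAlgebra p)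
    (hΨ : ∀ (r : IwasawaAlgebra p) (x : X), Ψ (r • x) = invol p r * Ψ x) (hne : ∃ y, Ψ y ≠ 0) {x x' : X}
    (h : Ψ x = Ψ x') : x - x' ∈ Submodule.torsion (IwasawaAlgebra p) X :=
  (involSemilinear_apply_eq_zero_iff_mem_torsion hX Ψ hΨ hne (x - x')).mp (by rw [map_sub, h, sub_self])

end Literature.NumberTheory.EllipticCurves.IwasawaAlgebra

end
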